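import Literature.NumberTheory.LFunctions.WeilLogLatticeCombNorm
import Literature.NumberTheory.LFunctions.MollifiedCoefficientsMeanSquare
import HarnessLib

/-!
# The `L²` norm of the `ζ`-mollified resonator comb from below: `‖g‖₂² ≫ (κ/M) log(M/κ)`

Topic `Literature/NumberTheory/LFunctions`. For the comb
`g(u) = ∑_{m ≤ LM} a_m b₁((u - log m) M/κ)`, `a_m = ∑_{k ∣ m, k ≤ M} α(m/k)/√k`, with a real
resonator `α` supported on `[1, L]` and not identically zero there, and a bump `b₁` supported in
`[-1, 1]`: the teeth `m ≤ M/(4κ)` are pairwise disjoint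
(`Literature/NumberTheory/LFunctions/WeilLogLatticeCombNorm.lean`), and their coefficients have
mean square `≫ log(M/κ)` (`Literature/NumberTheory/LFunctions/MollifiedCoefficientsMeanSquare.lean`):

* `Literature.NumberTheory.LFunctions.exists_integral_norm_sq_comb_ge` —
  `(κ/M) ‖b₁‖₂² (c log(M/κ) - C) ≤ ‖g‖₂²` for `1 ≤ κ`, `8κ ≤ M`, with `c > 0`, `C ≥ 0`
  depending only on `α`, `L`.

## References

* K. Soundararajan, *Extreme values of zeta and L-functions*, Math. Ann. 342 (2008), §2.
* E. Bombieri, *Remarks on Weil's quadratic functional in the theory of prime numbers I* (2000), §4.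
-/

noncomputable section

open Complex MeasureTheory Set Filter Finset
open scoped Real Topology

namespace Literature.NumberTheory.LFunctions

/-- **`‖g‖₂² ≫ (κ/M) log(M/κ)` for the `ζ`-mollified resonator comb.** For a real resonator `α`
supported on `[1, L]` with `α_ℓ ≠ 0` for some `1 ≤ ℓ ≤ L`, and a Weil test function `b₁`
supported in `[-1, 1]`, there are `c > 0`, `C ≥ 0` such that for all `M` and `1 ≤ κ` with
`8κ ≤ M`,
`(κ/M) (∫ ‖b₁‖²) (c log(M/κ) - C) ≤ ∫ ‖∑_{m ≤ LM} a_m b₁((u - log m) M/κ)‖² du`.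
[cite: Soundararajan2008Extreme, §2] -/
theorem exists_integral_norm_sq_comb_ge {α : ℕ → ℝ} {L : ℕ} (hα : ∀ m, L < m → α m = 0)
    (hne : ∃ ℓ, 1 ≤ ℓ ∧ ℓ ≤ L ∧ α ℓ ≠ 0) {b₁ : ℝ → ℂ} (hb : IsWeilTest b₁)
    (hsupp : tsupport b₁ ⊆ Set.Icc (-1) 1) :
    ∃ c : ℝ, 0 < c ∧ ∃ C : ℝ, 0 ≤ C ∧ ∀ (M : ℕ) (κ : ℝ), 1 ≤ κ → 8 * κ ≤ M →
      κ / M * (∫ u, ‖b₁ u‖ ^ 2) * (c * Real.log (M / κ) - C)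
        ≤ ∫ u, ‖∑ m ∈ Finset.range (L * M + 1),
            ((∑ k ∈ (Nat.divisors m).filter (· ≤ M), α (m / k) / Real.sqrt k : ℝ) : ℂ) *
              b₁ ((u - Real.log m) * ((M : ℝ) / κ))‖ ^ 2 := by
  obtain ⟨c, hc, C₀, hC₀, hms⟩ := exists_sum_sq_divisorConv_ge hα hne
  have hlog8 : 0 ≤ Real.log 8 := Real.log_nonneg (by norm_num)
  refine ⟨c, hc, C₀ + c * Real.log 8, by positivity, ?_⟩
  intro M κ hκ1 hκM
  obtain ⟨ℓ₁, hℓ₁1, hℓ₁L, -⟩ := hne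
  have hL1 : 1 ≤ L := hℓ₁1.trans hℓ₁L
  have hκ0 : 0 < κ := by linarith
  have hM0 : (0 : ℝ) < M := by linarith
  set lam : ℝ := (M : ℝ) / κ with hlam
  have hlam8 : 8 ≤ lam := by rw [hlam, le_div_iff₀ hκ0]; linarith
  have hlam0 : 0 < lam := by linarith
  -- the separated range `m ≤ m₀ = ⌊λ/4⌋`
  set m₀ : ℕ := ⌊lam / 4⌋₊ with hm₀
  have hm₀le : (m₀ : ℝ) ≤ lam / 4 := Nat.floor_le (by positivity)
  have hm₀ge : lam / 4 - 1 < m₀ := by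
    have := Nat.lt_floor_add_one (lam / 4); rw [← hm₀] at this; linarith
  have hm₀2 : 1 ≤ m₀ := by
    have : (1 : ℝ) < m₀ := by linarith
    exact_mod_cast this.le
  have hm₀M : m₀ ≤ M := by
    have h1 : (m₀ : ℝ) ≤ M := by
      calc (m₀ : ℝ) ≤ lam / 4 := hm₀le
        _ ≤ lam := by linarith
        _ ≤ M := by rw [hlam, div_le_iff₀ hκ0]; nlinarith
    exact_mod_cast h1
  have hm₀N : m₀ < L * M + 1 := by
    have : m₀ ≤ L * M := hm₀M.trans (Nat.le_mul_of_pos_left M hL1)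
    omega
  have hsepl : 2 * ((m₀ : ℝ) + 1) < lam := by linarith
  -- the coefficients as complex numbers
  set a : ℕ → ℝ := fun m ↦ ∑ k ∈ (Nat.divisors m).filter (· ≤ M), α (m / k) / Real.sqrt k with ha
  set cc : ℕ → ℂ := fun m ↦ ((a m : ℝ) : ℂ) with hcc
  have hcc0 : cc 0 = 0 := by simp [hcc, ha]
  -- separation of the teeth
  have hsep : ∀ m ∈ Finset.Icc 1 m₀, ∀ m' ∈ Finset.range (L * M + 1), m' ≠ m → m' ≠ 0 →
      2 / lam < |Real.log m' - Real.log m| := by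
    intro m hm m' _ hne' hm'0
    obtain ⟨hm1, hmm₀⟩ := Finset.mem_Icc.1 hm
    exact abs_log_sub_log_gt_of_le hsepl hm1 hmm₀ (Nat.pos_of_ne_zero hm'0) hne'
  -- the two inputs
  have hteeth := integral_norm_sq_logComb_ge hb hsupp hcc0 hm₀N hlam0 hsep
  have hcoef := hms m₀ M hm₀2 hm₀M
  have hnorm : ∀ m, ‖cc m‖ ^ 2 = a m ^ 2 := fun m ↦ by
    simp only [hcc, Complex.norm_real, Real.norm_eq_abs, sq_abs]
  simp only [hnorm] at hteeth
  -- `log m₀ ≥ log λ - log 8`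
  have hlogm₀ : Real.log lam - Real.log 8 ≤ Real.log m₀ := by
    have h1 : lam / 8 ≤ m₀ := by linarith
    rw [← Real.log_div hlam0.ne' (by norm_num)]
    exact Real.log_le_log (by positivity) h1
  have hB : 0 ≤ ∫ u, ‖b₁ u‖ ^ 2 := integral_nonneg fun u ↦ by positivity
  have hlaminv : lam⁻¹ = κ / M := by rw [hlam, inv_div]
  rw [hlaminv] at hteeth
  -- assemble
  have hchain : c * Real.log (M / κ) - (C₀ + c * Real.log 8) ≤ ∑ m ∈ Finset.Icc 1 m₀, a m ^ 2 := by
    have : c * (Real.log lam - Real.log 8) ≤ c * Real.log m₀ := mul_le_mul_of_nonneg_left hlogm₀ hc.le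
    rw [← hlam]
    linarith
  calc κ / M * (∫ u, ‖b₁ u‖ ^ 2) * (c * Real.log (M / κ) - (C₀ + c * Real.log 8))
      ≤ κ / M * (∫ u, ‖b₁ u‖ ^ 2) * ∑ m ∈ Finset.Icc 1 m₀, a m ^ 2 :=
        mul_le_mul_of_nonneg_left hchain (by positivity)
    _ = (∑ m ∈ Finset.Icc 1 m₀, a m ^ 2) * (κ / M * ∫ u, ‖b₁ u‖ ^ 2) := by ring
    _ ≤ _ := hteeth

end Literature.NumberTheory.LFunctions
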